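import Mathlib.MeasureTheory.Measure.Lebesgue.VolumeOfBalls
import Mathlib.MeasureTheory.Measure.Haar.InnerProductSpace
import Mathlib.MeasureTheory.Measure.Lebesgue.EqHaar
import Mathlib.LinearAlgebra.Determinant
import Mathlib.Topology.Instances.Matrix
import HarnessLib

/-!
# Integer points `z ∈ ℤ²` with `A z + b` in a disc: the UPPER count `≤ π (ρ + r)² / |det A|`

HONEST FRAMING. Part of the venture `Summits/Ventures/Crystal3D` (cell `crystal3d-full`), helper for the
crux `GenericWallFloor` (stmt-Ventures-19480) of `route-Ventures-StickyWulffConstant`, line `WallLedgerG`: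
the rigid-bicrystal rung of `stub_twoSlabAdhesion` needs the number of bond lines through a clamped slab
sample from ABOVE (`D(P) ≤ 2φπρ² + Cρ`), i.e. the mirror image of `affine_disc_count`
(`StickySpheres/AffineDiscCount.lean`, the lower count `π(ρ − r)² ≤ |det A| · #T`).  Elementary geometry of
numbers; nothing about packings.

**Theorem** (`affine_disc_count_upper`).  Let `A` be a real `2 × 2` matrix with `det A ≠ 0`, `b, c ∈ ℝ²`,
`r ≥ 0` a bound for `‖A f‖` over the unit square `f ∈ [0,1)²`, `ρ ≥ 0`, and `T ⊆ ℤ²` a finite set all of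
whose members `z` satisfy `|A z + b − c| ≤ ρ`.  Then `|det A| · #T ≤ π (ρ + r)²`.
Proof: the half-open parallelograms `A(z + [0,1)²) + b`, `z ∈ T`, are pairwise disjoint, have area `|det A|`
each, and lie in the disc of radius `ρ + r` about `c`.

WHAT THIS IS NOT: nothing about lattices in `ℝ³` yet (the line counts are assembled elsewhere); rung F-C1
not moved.
-/

noncomputable section

namespace Summit.Ventures.Crystal3D.Theorems

open MeasureTheory Set Finset

/-- **Upper affine disc count in `ℤ²`.**  For a real `2 × 2` matrix `A` with `det A ≠ 0`, vectors
`b c : Fin 2 → ℝ`, a bound `r ≥ 0` with `(A f)₀² + (A f)₁² ≤ r²` for all `f ∈ [0,1)²`, `ρ ≥ 0`, and a finite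
`T ⊆ ℤ²` such that every `z ∈ T` has `((A z + b)₀ − c₀)² + ((A z + b)₁ − c₁)² ≤ ρ²`:
`|det A| · #T ≤ π (ρ + r)²`. -/
theorem affine_disc_count_upper (A : Matrix (Fin 2) (Fin 2) ℝ) (hA : A.det ≠ 0) (b c : Fin 2 → ℝ)
    (r ρ : ℝ) (hr : 0 ≤ r) (hρ : 0 ≤ ρ)
    (hbound : ∀ f : Fin 2 → ℝ, (∀ m, 0 ≤ f m ∧ f m < 1) →
      (A.mulVec f 0) ^ 2 + (A.mulVec f 1) ^ 2 ≤ r ^ 2)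
    (T : Finset (ℤ × ℤ))
    (hT : ∀ p ∈ T,
      (A.mulVec ![(p.1 : ℝ), (p.2 : ℝ)] 0 + b 0 - c 0) ^ 2 +
        (A.mulVec ![(p.1 : ℝ), (p.2 : ℝ)] 1 + b 1 - c 1) ^ 2 ≤ ρ ^ 2) :
    |A.det| * (T.card : ℝ) ≤ Real.pi * (ρ + r) ^ 2 := by
  classical
  -- the inverse matrix
  have hAunit : IsUnit A.det := isUnit_iff_ne_zero.2 hA
  have hinv : ∀ y, A.mulVec (A⁻¹.mulVec y) = y := fun y => by
    rw [Matrix.mulVec_mulVec, Matrix.mul_nonsing_inv _ hAunit, Matrix.one_mulVec]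
  have hinv' : ∀ x, A⁻¹.mulVec (A.mulVec x) = x := fun x => by
    rw [Matrix.mulVec_mulVec, Matrix.nonsing_inv_mul _ hAunit, Matrix.one_mulVec]
  -- boxes and the parallelograms as preimages
  set Box : ℤ × ℤ → Set (Fin 2 → ℝ) := fun p =>
    Set.pi Set.univ fun m : Fin 2 =>
      Ico ((![(p.1 : ℝ), (p.2 : ℝ)] : Fin 2 → ℝ) m) ((![(p.1 : ℝ), (p.2 : ℝ)] : Fin 2 → ℝ) m + 1)
    with hBox
  have hBoxvol : ∀ p, volume (Box p) = 1 := by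
    intro p; rw [hBox]; simp only; rw [Real.volume_pi_Ico]; simp
  have hBoxmeas : ∀ p, MeasurableSet (Box p) := by
    intro p; rw [hBox]
    exact MeasurableSet.univ_pi fun m => measurableSet_Ico
  set F : (Fin 2 → ℝ) → (Fin 2 → ℝ) := fun y => A⁻¹.mulVec (y - b) with hF
  have hFcont : Continuous F := by
    rw [hF]
    exact Continuous.matrix_mulVec continuous_const (continuous_id.sub continuous_const)
  set P : ℤ × ℤ → Set (Fin 2 → ℝ) := fun p => F ⁻¹' Box p with hP
  have hPmeas : ∀ p, MeasurableSet (P p) := fun p => (hBoxmeas p).preimage hFcont.measurable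
  -- volume of a parallelogram
  set L : (Fin 2 → ℝ) →ₗ[ℝ] (Fin 2 → ℝ) := Matrix.toLin' A⁻¹ with hL
  have hLdet : LinearMap.det L ≠ 0 := by
    rw [hL, LinearMap.det_toLin', Matrix.det_nonsing_inv, Ring.inverse_eq_inv]
    exact inv_ne_zero hA
  have hPvol : ∀ p, volume (P p) = ENNReal.ofReal |A.det| := by
    intro p
    have hPre : P p = (fun y => y + (-b)) ⁻¹' (L ⁻¹' Box p) := by
      ext y; simp [hP, hF, hL, Matrix.toLin'_apply, sub_eq_add_neg]
    rw [hPre, measure_preimage_add_right, MeasureTheory.Measure.addHaar_preimage_linearMap _ hLdet,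
      hBoxvol, mul_one, hL, LinearMap.det_toLin', Matrix.det_nonsing_inv]
    congr 1
    rw [Ring.inverse_eq_inv, inv_inv]
  -- pairwise disjoint
  have hdisj : Set.PairwiseDisjoint (↑T : Set (ℤ × ℤ)) P := by
    intro p _ q _ hpq
    rw [Function.onFun, Set.disjoint_left]
    intro y hyp hyq
    apply hpq
    rw [hP] at hyp hyq
    simp only [Set.mem_preimage, hBox, Set.mem_pi, Set.mem_univ, Set.mem_Ico, forall_true_left] at hyp hyq
    have h0p := hyp 0; have h0q := hyq 0; have h1p := hyp 1; have h1q := hyq 1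
    simp only [Matrix.cons_val_zero, Matrix.cons_val_one] at h0p h0q h1p h1q
    have e1 : p.1 = q.1 := by
      have a1 : p.1 < q.1 + 1 := by exact_mod_cast (h0p.1.trans_lt h0q.2)
      have a2 : q.1 < p.1 + 1 := by exact_mod_cast (h0q.1.trans_lt h0p.2)
      omega
    have e2 : p.2 = q.2 := by
      have a1 : p.2 < q.2 + 1 := by exact_mod_cast (h1p.1.trans_lt h1q.2)
      have a2 : q.2 < p.2 + 1 := by exact_mod_cast (h1q.1.trans_lt h1p.2)
      omega
    exact Prod.ext e1 e2
  -- the big disc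
  set D : Set (Fin 2 → ℝ) :=
    (WithLp.toLp 2 : (Fin 2 → ℝ) → EuclideanSpace ℝ (Fin 2)) ⁻¹'
      Metric.closedBall (WithLp.toLp 2 c) (ρ + r) with hD
  have hDvol : volume D = ENNReal.ofReal (ρ + r) ^ 2 * ENNReal.ofReal Real.pi := by
    rw [hD, (PiLp.volume_preserving_toLp (Fin 2)).measure_preimage
      measurableSet_closedBall.nullMeasurableSet, EuclideanSpace.volume_closedBall_fin_two]
  have hdist : ∀ u v : Fin 2 → ℝ,
      dist (WithLp.toLp 2 u : EuclideanSpace ℝ (Fin 2)) (WithLp.toLp 2 v) =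
        Real.sqrt ((u 0 - v 0) ^ 2 + (u 1 - v 1) ^ 2) := by
    intro u v
    rw [EuclideanSpace.dist_eq, Fin.sum_univ_two]
    simp only [Real.dist_eq, sq_abs]
  -- each parallelogram lies in the big disc
  have hsub : ∀ p ∈ T, P p ⊆ D := by
    intro p hp y hy
    rw [hP] at hy
    simp only [Set.mem_preimage, hBox, Set.mem_pi, Set.mem_univ, Set.mem_Ico, forall_true_left] at hy
    -- fractional part
    set x : Fin 2 → ℝ := F y with hx
    set f : Fin 2 → ℝ := ![x 0 - p.1, x 1 - p.2] with hf
    have hx0 := hy 0; have hx1 := hy 1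
    simp only [Matrix.cons_val_zero, Matrix.cons_val_one] at hx0 hx1
    have hfbox : ∀ m, 0 ≤ f m ∧ f m < 1 := by
      intro m; fin_cases m
      · simp [hf]; constructor <;> linarith [hx0.1, hx0.2]
      · simp [hf]; constructor <;> linarith [hx1.1, hx1.2]
    have hxdecomp : x = ![(p.1 : ℝ), (p.2 : ℝ)] + f := by
      funext m; fin_cases m <;> simp [hf]
    have hyx : y = A.mulVec x + b := by
      rw [hx, hF]; simp only; rw [hinv]; abel
    set q : Fin 2 → ℝ := A.mulVec ![(p.1 : ℝ), (p.2 : ℝ)] + b with hq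
    have hyq : ∀ m, y m - q m = A.mulVec f m := by
      intro m
      rw [hyx, hxdecomp, Matrix.mulVec_add, hq]
      simp only [Pi.add_apply]; ring
    rw [hD, Set.mem_preimage, Metric.mem_closedBall]
    have hyq' : dist (WithLp.toLp 2 y : EuclideanSpace ℝ (Fin 2)) (WithLp.toLp 2 q) ≤ r := by
      rw [hdist, hyq 0, hyq 1]
      calc Real.sqrt ((A.mulVec f 0) ^ 2 + (A.mulVec f 1) ^ 2) ≤ Real.sqrt (r ^ 2) :=
            Real.sqrt_le_sqrt (hbound f hfbox)
        _ = r := Real.sqrt_sq hr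
    have hqc : dist (WithLp.toLp 2 q : EuclideanSpace ℝ (Fin 2)) (WithLp.toLp 2 c) ≤ ρ := by
      rw [hdist]
      calc Real.sqrt ((q 0 - c 0) ^ 2 + (q 1 - c 1) ^ 2) ≤ Real.sqrt (ρ ^ 2) := by
            apply Real.sqrt_le_sqrt
            have := hT p hp
            simpa [hq] using this
        _ = ρ := Real.sqrt_sq hρ
    have := dist_triangle (WithLp.toLp 2 y : EuclideanSpace ℝ (Fin 2)) (WithLp.toLp 2 q)
      (WithLp.toLp 2 c)
    linarith
  -- measure comparison
  have hle : (T.card : ENNReal) * ENNReal.ofReal |A.det| ≤ volume D := by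
    calc (T.card : ENNReal) * ENNReal.ofReal |A.det| = ∑ p ∈ T, ENNReal.ofReal |A.det| := by
          rw [sum_const, nsmul_eq_mul]
      _ = ∑ p ∈ T, volume (P p) := sum_congr rfl fun p _ => (hPvol p).symm
      _ = volume (⋃ p ∈ T, P p) := (measure_biUnion_finset hdisj fun p _ => hPmeas p).symm
      _ ≤ volume D := measure_mono (Set.iUnion₂_subset hsub)
  rw [hDvol] at hle
  have hρr : 0 ≤ ρ + r := by linarith
  have hle' : ENNReal.ofReal ((T.card : ℝ) * |A.det|) ≤ ENNReal.ofReal ((ρ + r) ^ 2 * Real.pi) := by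
    rw [ENNReal.ofReal_mul (sq_nonneg _), ENNReal.ofReal_pow hρr,
      ENNReal.ofReal_mul (Nat.cast_nonneg _), ENNReal.ofReal_natCast]
    exact hle
  have hreal := (ENNReal.ofReal_le_ofReal_iff (by positivity)).1 hle'
  linarith

end Summit.Ventures.Crystal3D.Theorems

end
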